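import Mathlib.GroupTheory.Torsion
import Mathlib.Data.ZMod.Basic
import Mathlib.Data.ZMod.ValMinAbs
import Mathlib.Algebra.Ring.Commute
import Mathlib.Logic.Function.Basic
import Mathlib.Tactic.Ring
import Mathlib.Tactic.Linarith
import HarnessLib

/-!
# [IUTchII] Corollaries 2.8, 2.9 and Remarks 2.8.1–2.8.3, 2.9.1: mono-theta-theoretic and
# base-field-theoretic theta evaluation (abc-iut cell, layer L6; idle-typer BLOCK A of
# plan/L6/ASSIGNMENTS.md §5 v1.4, claimed by abc-iut-L6-t4 on STATUS 2026-08-25T18:37Z)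

S. Mochizuki, *Inter-universal Teichmüller theory II: Hodge–Arakelov-theoretic evaluation*, kurims
manuscript (Dec. 2020) of PRIMS **57** (2021), §2: Corollary 2.8 "(Mono-theta-theoretic Theta
Evaluation)" pp. 81–83, Remarks 2.8.1–2.8.3 pp. 83–84, Corollary 2.9 "(Theta Evaluation via
Base-field-theoretic Cyclotomes)" pp. 84–85, Remark 2.9.1 pp. 85–86. Both corollaries are "functorial
group-theoretic evaluation algorithms" whose printed proofs are "follow immediately from the
definitions". STATEMENTS-FIRST typing over INTERFACES (C3/C4): the inputs — projective systems of
mono-theta environments `𝕄^Θ_*` and their cyclotomes `Π_μ(−)`, `(l·Δ_Θ)(−)` with the cyclotomic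
rigidity isomorphisms (Prop. 1.4, 1.5, Def. 2.7 (ii); abc-iut-L6-t1 `MonoThetaProjSystem`,
`ThetaEnvData` (`.thetaEnv`, `.thetaEnvInfty`), `CyclotomicRigidity`, `CohomologySystem` (`H1`, `res`,
`lim`), `EtaleThetaData`, `IotaInvariantTheta` (`.thetaIota`, `.thetaInftyIota`), `ThetaEvaluation`
(`MxTM`, `MxmuTM`), `Cor112_ii` — staged behind p403770, TODO-merge; names per L6-t1 INBOX 18:40:59Z),
the subgroups `Π_{v⩒▶} ⊆ Π_v` (`SubgraphDecomposition`), the evaluation sections/decomposition groups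
`D^δ_{t,μ_-}` (`TwoTorsionTranslates.Dtmu`) and labels `LabCusp^±(Π_v) → |𝔽_l|` (`LabCuspPM`,
`LabCuspStructure.toFl`; Cor. 2.4, 2.5, 2.6; abc-iut-L6-t2 BLOCK B, TODO-merge) — enter as abstract
types and maps; cohomology modules are written ADDITIVELY (as in abc-iut-L6-t1's files), so that a
"`μ_{2l}`-orbit" (resp. "`μ`-orbit") of a class `η` is `η +` (the `2l`-torsion) (resp. `η +` torsion):
`mu2lOrbit`, `muOrbit` (REAL). OUTPUT SIGNATURES: `MonoThetaEvaluationData` (Cor. 2.8 (i)) and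
`BaseFieldThetaEvaluationData` (Cor. 2.9 (i)) record the orbit-sets `θ^t_env ⊆ ∞θ^t_env` with their
printed properties; `thetaAbs` realises "Thus, we shall write `θ^{|t|}_env := θ^t_env`" (well-definedness
PROVED from the field "depend only on the label `|t|`"); (ii) and (iii) of each corollary are
`Prop`-valued definitions over abstract data. These orbit-sets are what abc-iut-L6-t2's
`Literature.IUT.HodgeArakelov.ValueProfileData` (BadPrimeGaussianMonoids.lean, field `thetaValues`)
consumes after Kummer transport (Cor. 3.5 (i)). REAL and PROVED: Remark 2.8.3 (i) (every class mod an
odd `l` has a unique representative of absolute value `≤ l^⋇`, via `ZMod.valMinAbs`) and the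
"discreteness of squares … the quotient of `ℤ` by `{±1}`" of Remark 2.8.3 (ii). Deliberately NOT typed
beyond docstrings (C1, expository): Remark 2.8.2 (relation to Frobenioid-theoretic theta functions of
[EtTh] §5), Remark 2.8.3 (ii) remainder (duality of discrete and cyclotomic rigidity), Remark 2.9.1
(iii) second half (forward reference to [IUTchIII] log-shells). Tag form
[claim: Mochizuki2012, status: disputed] (D-0012 claim key).
-/

namespace Literature.IUT.HodgeArakelov

namespace ThetaValueOrbits

universe u v

/-! ### Orbits under roots of unity in an additively written cohomology module -/

section Orbits

variable {H : Type u} [AddCommGroup H]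

/-- The `μ`-orbit of a class `η` in an (additively written) cohomology module `lim_J H¹(−, Π_μ(−))`:
translates of `η` by torsion classes (Kummer classes of roots of unity) — the "`μ`-orbits of elements"
of [IUTchII] Cor. 2.8 (i), p. 82. [claim: Mochizuki2012, status: disputed] -/
def muOrbit (η : H) : Set H := {η' | ∃ τ : H, IsOfFinAddOrder τ ∧ η' = η + τ}

/-- The `μ_{2l}`-orbit of a class `η`: translates by `2l`-torsion classes ("`μ_{2l}`-orbits of elements",
[IUTchII] Cor. 2.8 (i), p. 82). [claim: Mochizuki2012, status: disputed] -/
def mu2lOrbit (twoL : ℕ) (η : H) : Set H := {η' | ∃ τ : H, twoL • τ = 0 ∧ η' = η + τ}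

/-- `μ_{2l}`-orbits are contained in `μ`-orbits (`θ ⊆ ∞θ`, Cor. 2.8 (i), p. 82) — PROVED for `2l ≥ 1`.
[claim: Mochizuki2012, status: disputed] -/
theorem mu2lOrbit_subset_muOrbit {twoL : ℕ} (h : 0 < twoL) (η : H) :
    mu2lOrbit twoL η ⊆ muOrbit η := by
  rintro _ ⟨τ, hτ, rfl⟩
  exact ⟨τ, isOfFinAddOrder_iff_nsmul_eq_zero.mpr ⟨twoL, h, hτ⟩, rfl⟩

/-- `η` lies in its own orbits (Cor. 2.8 (i): "orbits of elements") — PROVED.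
[claim: Mochizuki2012, status: disputed] -/
theorem mem_mu2lOrbit_self (twoL : ℕ) (η : H) : η ∈ mu2lOrbit twoL η :=
  ⟨0, by simp, by simp⟩

/-- A homomorphism of cohomology modules (e.g. restriction to a decomposition group `D^δ_{t,μ_-}`,
Cor. 2.8 (i), p. 82) maps `μ_{2l}`-orbits into `μ_{2l}`-orbits — PROVED.
[claim: Mochizuki2012, status: disputed] -/
theorem image_mu2lOrbit_subset {HG : Type v} [AddCommGroup HG] (f : H →+ HG) (twoL : ℕ) (η : H) :
    f '' mu2lOrbit twoL η ⊆ mu2lOrbit twoL (f η) := by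
  rintro _ ⟨_, ⟨τ, hτ, rfl⟩, rfl⟩
  exact ⟨f τ, by rw [← map_nsmul, hτ, map_zero], by rw [map_add]⟩

end Orbits

/-! ### Corollary 2.8: mono-theta-theoretic theta evaluation (output signature) -/

section Cor28

variable (twoL : ℕ) (LabCusp : Type u) (LabAbs : Type u) (abs : LabCusp → LabAbs)
variable (H HG : Type v) [AddCommGroup H] [AddCommGroup HG]

/-- **IUTchII:Cor2.8(i)** (kurims p.81 l.77 – p.82) OUTPUT SIGNATURE of "(Restriction of Étale Theta
Functions to Subgraphs and Evaluation Points)": after applying the cyclotomic rigidity isomorphisms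
`(l·Δ_Θ)((𝕄^Θ_{*⩒▶})^γ) ≅ Π_μ((𝕄^Θ_{*⩒▶})^γ)` of Def. 2.7 (ii) "to replace '`(l·Δ_Θ)(−)`' by '`Π_μ(−)`'", "the
`ι^γ`-invariant subsets `θ^ι(Π^γ_v) ⊆ θ(Π^γ_v)`, `∞θ^ι(Π^γ_v) ⊆ ∞θ(Π^γ_v)` … determine `ι^γ`-invariant subsets
`θ^ι_env((𝕄^Θ_*)^γ) ⊆ θ_env((𝕄^Θ_*)^γ)`; … restriction of these subsets … to `Π_{v⩒▶}((𝕄^Θ_{*⩒▶})^γ)` yields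
`μ_{2l}`-, `μ`-orbits of elements `θ^ι_env((𝕄^Θ_{*⩒▶})^γ) ⊆ ∞θ^ι_env((𝕄^Θ_{*⩒▶})^γ) ⊆ lim_Ĵ H¹(Π_{v⩒▶}(…)|_Ĵ, Π_μ(…))`
… which, upon further restriction to the decomposition groups `D^δ_{t,μ_-}` …, yield `μ_{2l}`-, `μ`-orbits of
elements `θ^t_env ⊆ ∞θ^t_env ⊆ lim_{J_G} H¹(G_v(…)|_{J_G}, Π_μ(…))` for each `t ∈ LabCusp^±(Π^γ_v)`"; "the sets
`θ^t_env`, `∞θ^t_env` depend only on the label `|t| ∈ |𝔽_l|`". Interface: `H` = the module on `Π_{v⩒▶}`,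
`HG` = the module on `G_v`, `res t : H →+ HG` = restriction to `D^δ_{t,μ_-}`, `abs : LabCusp → LabAbs` =
`t ↦ |t|` (TODO-merge: abc-iut-L6-t1 `CohomologySystem`/`ThetaEvaluation`; abc-iut-L6-t2 Cor. 2.4–2.6).
[claim: Mochizuki2012, status: disputed] -/
structure MonoThetaEvaluationData where
  /-- restriction to the decomposition group `D^δ_{t,μ_-}` of the evaluation point labelled `t` -/
  res : LabCusp → (H →+ HG)
  /-- `θ^ι_env((𝕄^Θ_{*⩒▶})^γ)`: the `μ_{2l}`-orbit obtained by restriction to `Π_{v⩒▶}` -/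
  thetaIota : Set H
  /-- `∞θ^ι_env((𝕄^Θ_{*⩒▶})^γ)`: the `μ`-orbit -/
  thetaInftyIota : Set H
  /-- "`μ_{2l}`-orbits of elements" -/
  thetaIota_isOrbit : ∃ η, thetaIota = mu2lOrbit twoL η
  /-- "`μ`-orbits of elements" -/
  thetaInftyIota_isOrbit : ∃ η, thetaInftyIota = muOrbit η
  /-- `θ^ι_env ⊆ ∞θ^ι_env` -/
  thetaIota_subset : thetaIota ⊆ thetaInftyIota
  /-- `θ^t_env((𝕄^Θ_{*⩒▶})^γ) ⊆ lim H¹(G_v(…), Π_μ(…))` -/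
  thetaT : LabCusp → Set HG
  /-- `∞θ^t_env` -/
  thetaInftyT : LabCusp → Set HG
  /-- `θ^t_env` is the `μ_{2l}`-orbit generated by the restriction of `θ^ι_env` -/
  thetaT_isOrbit : ∀ t, ∃ η ∈ thetaIota, thetaT t = mu2lOrbit twoL (res t η)
  /-- `∞θ^t_env` is the `μ`-orbit generated by the restriction of `∞θ^ι_env` -/
  thetaInftyT_isOrbit : ∀ t, ∃ η ∈ thetaInftyIota, thetaInftyT t = muOrbit (res t η)
  /-- `θ^t_env ⊆ ∞θ^t_env` -/
  thetaT_subset : ∀ t, thetaT t ⊆ thetaInftyT t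
  /-- "depend only on the label `|t| ∈ |𝔽_l|` determined by `t`" -/
  thetaT_dependsOnlyOnAbs : ∀ t t', abs t = abs t' → thetaT t = thetaT t'
  /-- idem for `∞θ^t_env` -/
  thetaInftyT_dependsOnlyOnAbs : ∀ t t', abs t = abs t' → thetaInftyT t = thetaInftyT t'

variable {twoL LabCusp LabAbs abs H HG}

/-- **IUTchII:Cor2.8(i)** (kurims p.82 l.32) "Thus, we shall write `θ^{|t|}_env := θ^t_env`,
`∞θ^{|t|}_env := ∞θ^t_env`": the orbit-set indexed by a label class `|t| ∈ |𝔽_l|`, defined through any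
representative (`abs` surjective); independence of the representative is `thetaAbs_eq`.
[claim: Mochizuki2012, status: disputed] -/
noncomputable def thetaAbs (D : MonoThetaEvaluationData twoL LabCusp LabAbs abs H HG)
    (habs : Function.Surjective abs) (a : LabAbs) : Set HG :=
  D.thetaT (Classical.choose (habs a))

/-- Well-definedness of `θ^{|t|}_env` (Cor. 2.8 (i), p.82 l.32) — PROVED from "depend only on the label".
[claim: Mochizuki2012, status: disputed] -/
theorem thetaAbs_eq (D : MonoThetaEvaluationData twoL LabCusp LabAbs abs H HG)
    (habs : Function.Surjective abs) (t : LabCusp) : thetaAbs D habs (abs t) = D.thetaT t :=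
  D.thetaT_dependsOnlyOnAbs _ _ (Classical.choose_spec (habs (abs t)))

/-- **IUTchII:Cor2.8(ii)** (kurims p.82 l.73) "(Functorial Group-theoretic Evaluation Algorithm)":
starting from "an arbitrary `Δ̂^±_v`-conjugate `Π_{v⩒▶}((𝕄^Θ_{*⩒▶})^γ)`" and "an arbitrary `Δ̂^±_v`-conjugate
`I^δ_t` of `I_t`", "one obtains an algorithm for constructing the collections of `μ_{2l}`-, `μ`-orbits
`{θ^{|t|}_env}_{|t|∈|𝔽_l|}`; `{∞θ^{|t|}_env}_{|t|∈|𝔽_l|}` which is functorial in the projective system of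
mono-theta environments `𝕄^Θ_*` and, moreover, compatible with the independent conjugacy actions of
`Δ̂^±_v` on the sets `{I^{γ₁}_t}_{γ₁}` and `{Π_{v⩒▶}((𝕄^Θ_{*⩒▶})^{γ₂})}_{γ₂}`". Typed over abstract data: the
algorithm's output as a function of the two independent choices `(γ₁, γ₂)` is constant (compatibility
with independent conjugacy actions), and for an isomorphism of projective systems inducing `φ` on the
coefficient modules the outputs correspond (functoriality). [claim: Mochizuki2012, status: disputed] -/
def Cor28ii_functorialAlgorithm {Conj₁ Conj₂ : Type u} (out : Conj₁ → Conj₂ → LabAbs → Set HG)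
    {HG' : Type v} (out' : LabAbs → Set HG') (φ : HG → HG') : Prop :=
  (∀ γ₁ γ₁' γ₂ γ₂', out γ₁ γ₂ = out γ₁' γ₂') ∧ ∀ γ₁ γ₂ a, out' a = φ '' out γ₁ γ₂ a

/-- **IUTchII:Cor2.8(iii)** (kurims p.82 l.117 – p.83 l.6) "(Splittings at Zero-labeled Evaluation
Points)": for `t` the zero element, after replacing `(l·Δ_Θ)(−)` by `Π_μ(−)` in Cor. 2.6 (ii), "the second
restriction operation … determines splittings `M^{×μ}_TM((𝕄^Θ_{*⩒▶})^γ) × {∞θ^ι_env((𝕄^Θ_{*⩒▶})^γ)/M^μ_TM(…)}`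
of `M^×_TM · ∞θ^ι_env(…)/M^μ_TM(…)` which are compatible, relative to the first restriction operation …,
with the splittings of Corollary 1.12, (ii)". Typed over abstract data: a bijection of the quotient set
`X = M^×_TM·∞θ^ι/M^μ_TM` with `U × Q` (`U = M^{×μ}_TM`, `Q = ∞θ^ι/M^μ_TM`) intertwined, via the maps
induced by the first restriction operation, with the Cor. 1.12 (ii) splitting `X₀ ≃ U₀ × Q₀`
(abc-iut-L6-t1 `Cor112_ii`). [claim: Mochizuki2012, status: disputed] -/
def Cor28iii_splitting {X U Q X₀ U₀ Q₀ : Type u} (split : X ≃ U × Q) (split₀ : X₀ ≃ U₀ × Q₀)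
    (rX : X₀ → X) (rU : U₀ → U) (rQ : Q₀ → Q) : Prop :=
  ∀ x₀ : X₀, split (rX x₀) = (rU (split₀ x₀).1, rQ (split₀ x₀).2)

/-- **IUTchII:Rmk2.8.1** (kurims p.83 l.26) "One may regard Corollaries 2.5, 2.6 as a special case of
Corollary 2.8, i.e., the case where the projective system of mono-theta environments `𝕄^Θ_*` arises from
the topological group `Π_v` by applying the functorial group-theoretic algorithm of Proposition 1.2,
(i)". Typed: the Cor. 2.8 output for the system `𝕄^Θ_*(Π_v)` coincides, under the identification `e` of
coefficient modules, with the Cor. 2.5 output. [claim: Mochizuki2012, status: disputed] -/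
def Rmk281_specialCase {HG₅ : Type v} (out₈ : LabAbs → Set HG) (out₅ : LabAbs → Set HG₅)
    (e : HG₅ ≃ HG) : Prop :=
  ∀ a, out₈ a = e '' out₅ a

/-- **IUTchII:Rmk2.8.3(i)** (kurims p.83 l.43) "The use of the archimedean line segment `Γ^▶_X ⊆ Γ_X`
… to single out the elements `∈ {−l^⋇, −l^⋇+1, …, −1, 0, 1, …, l^⋇−1, l^⋇}` — i.e., the elements with
absolute value `≤ l^⋇` — within the nonarchimedean congruence classes modulo `l`": for `l = 2l^⋇ + 1`,
every class modulo `l` has a representative of absolute value `≤ l^⋇` — PROVED (Mathlib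
`ZMod.valMinAbs`), uniqueness in `valMinAbs_unique`. [claim: Mochizuki2012, status: disputed] -/
theorem Rmk283i_representative (lstar : ℕ) (x : ZMod (2 * lstar + 1)) :
    ∃ a : ℤ, a.natAbs ≤ lstar ∧ (a : ZMod (2 * lstar + 1)) = x := by
  haveI : NeZero (2 * lstar + 1) := ⟨by omega⟩
  refine ⟨x.valMinAbs, ?_, ZMod.coe_valMinAbs x⟩
  have h := ZMod.natAbs_valMinAbs_le x
  omega

/-- **IUTchII:Rmk2.8.3(i)** (kurims p.83 l.43) uniqueness half: two integers of absolute value `≤ l^⋇`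
that are congruent modulo `l = 2l^⋇+1` are equal — PROVED. [claim: Mochizuki2012, status: disputed] -/
theorem Rmk283i_unique (lstar : ℕ) {a b : ℤ} (ha : a.natAbs ≤ lstar) (hb : b.natAbs ≤ lstar)
    (h : (a : ZMod (2 * lstar + 1)) = (b : ZMod (2 * lstar + 1))) : a = b := by
  rw [ZMod.intCast_eq_intCast_iff_dvd_sub] at h
  have h1 := Int.natAbs_sub_le b a
  have hlt : (b - a).natAbs < ((2 * lstar + 1 : ℕ) : ℤ).natAbs := by
    rw [Int.natAbs_natCast]
    omega
  have h0 := Int.eq_zero_of_dvd_of_natAbs_lt_natAbs h hlt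
  omega

/-- **IUTchII:Rmk2.8.3(ii)** (kurims p.83 l.52 – p.84) "discrete rigidity — in the form of the
discreteness of squares of elements of `ℤ`, i.e., in effect, the quotient of `ℤ` by the action of `{±1}` —
may be thought of as a sort of dual property to the cyclotomic rigidity": the typed nugget — an integer
is determined by its square up to sign — PROVED; the surrounding discussion (dependence on the
connectedness of `Γ^▶_X` and the discreteness of `ℤ ≅ ℤ̂`-free part; [EtTh] Prop. 1.4/1.5; [AbsTopIII] Cor.
1.10 (c)) is expository (C1, noted). [claim: Mochizuki2012, status: disputed] -/
theorem Rmk283ii_squares (a b : ℤ) : a ^ 2 = b ^ 2 ↔ a = b ∨ a = -b := sq_eq_sq_iff_eq_or_eq_neg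

end Cor28

/-! ### Corollary 2.9: theta evaluation via base-field-theoretic cyclotomes (output signature) -/

section Cor29

variable (twoL : ℕ) (LabCusp : Type u) (LabAbs : Type u) (abs : LabCusp → LabAbs)
variable (H HG : Type v) [AddCommGroup H] [AddCommGroup HG] (Zhat : Type v) [AddCommGroup Zhat]

/-- **IUTchII:Cor2.9(i)** (kurims p.84 l.28) OUTPUT SIGNATURE: with the cyclotomic rigidity isomorphisms
`μ_ℤ̂(G_v(Π_v)) ≅ (l·Δ_Θ)(Π_v)`, `μ_ℤ̂(G_v(Π^γ_{v⩒▶})) ≅ (l·Δ_Θ)(Π^γ_{v⩒▶})` "determined by the natural isomorphism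
'`μ_ℤ̂(G_k) ≅ μ_ℤ̂(Π_X)`' of [AbsTopIII], Corollary 1.10, (c)" used "to replace '`(l·Δ_Θ)(−)`' by
'`μ_ℤ̂(G_v(−))`'", one obtains "`ι^γ`-invariant subsets `θ^ι_bs(Π^γ_v) ⊆ θ_bs(Π^γ_v)`; `∞θ^ι_bs ⊆ ∞θ_bs`" ("bs"
= "base-field-theoretic"), whose restrictions to `Π^γ_{v⩒▶}` and then to `D^δ_{t,μ_-}` "yield `μ_{2l}`-,
`μ`-orbits of elements `θ^t_bs(Π^γ_{v⩒▶}) ⊆ ∞θ^t_bs(Π^γ_{v⩒▶}) ⊆ lim_{J_G} H¹(G_v(Π^γ_{v⩒▶})|_{J_G}, μ_ℤ̂(G_v(Π^γ_{v⩒▶})))`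
for each `t ∈ LabCusp^±`", which "depend only on the label `|t| ∈ |𝔽_l|`" (notation `θ^{|t|}_bs`,
`∞θ^{|t|}_bs`). Same shape as `MonoThetaEvaluationData` with coefficients `μ_ℤ̂(G_v(−))`, plus the
uniradially defined valuation surjection `H¹(G_v(−), μ_ℤ̂(G_v(−))) ↠ ℤ̂` of Remark 2.9.1 (ii) / Rmk. 1.11.5
(abc-iut-L6-t1 `ValuationSurjection`). [claim: Mochizuki2012, status: disputed] -/
structure BaseFieldThetaEvaluationData extends
    MonoThetaEvaluationData twoL LabCusp LabAbs abs H HG where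
  /-- the natural surjection `H¹(G_v(−), μ_ℤ̂(G_v(−))) ↠ ℤ̂` (Rmk. 1.11.5 (i), (ii); Rmk. 2.9.1 (ii)) -/
  valSurj : HG →+ Zhat
  /-- it is surjective -/
  valSurj_surjective : Function.Surjective valSurj

variable {twoL LabCusp LabAbs abs H HG Zhat}

/-- **IUTchII:Cor2.9(ii)** (kurims p.85 l.2) "(Functorial Group-theoretic Evaluation Algorithm)": "an
algorithm for constructing the collections of `μ_{2l}`-, `μ`-orbits `{θ^{|t|}_bs(Π^γ_{v⩒▶})}_{|t|∈|𝔽_l|}`;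
`{∞θ^{|t|}_bs(Π^γ_{v⩒▶})}_{|t|∈|𝔽_l|}` which is functorial in the topological group `Π_v` and, moreover,
compatible with the independent conjugacy actions of `Δ̂^±_v` on the sets `{I^{γ₁}_t}_{γ₁}` … and
`{Π^{γ₂}_{v⩒▶}}_{γ₂}`" — typed exactly as `Cor28ii_functorialAlgorithm` (independence of the two choices;
transport under isomorphisms `Π_v ≅ Π'_v`). [claim: Mochizuki2012, status: disputed] -/
def Cor29ii_functorialAlgorithm {Conj₁ Conj₂ : Type u} (out : Conj₁ → Conj₂ → LabAbs → Set HG)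
    {HG' : Type v} (out' : LabAbs → Set HG') (φ : HG → HG') : Prop :=
  Cor28ii_functorialAlgorithm out out' φ

/-- **IUTchII:Cor2.9(iii)** (kurims p.85 l.42) "(Splittings at Zero-labeled Evaluation Points)": for `t`
the zero element, replacing `(l·Δ_Θ)(−)` by `μ_ℤ̂(G_v(−))` (subscript "bs") in Cor. 2.6 (ii), "the second
restriction operation … determines splittings `M^{×μ}_TM(Π^γ_{v⩒▶})_bs × {∞θ^ι_bs(Π^γ_{v⩒▶})/M^μ_TM(Π^γ_{v⩒▶})_bs}`
of `M^×_TM · ∞θ^ι_bs(Π^γ_{v⩒▶})/M^μ_TM(Π^γ_{v⩒▶})_bs` which are compatible, relative to the first restriction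
operation … and the cyclotomic rigidity isomorphisms reviewed above, with the splittings of Corollary
1.12, (ii)" — typed as `Cor28iii_splitting`. [claim: Mochizuki2012, status: disputed] -/
def Cor29iii_splitting {X U Q X₀ U₀ Q₀ : Type u} (split : X ≃ U × Q) (split₀ : X₀ ≃ U₀ × Q₀)
    (rX : X₀ → X) (rU : U₀ → U) (rQ : Q₀ → Q) : Prop :=
  Cor28iii_splitting split split₀ rX rU rQ

/-- **IUTchII:Rmk2.9.1(i)** (kurims p.85 l.67) "[the cyclotomic rigidity isomorphisms involving] the
cyclotomes '`Π_μ(−)`' that appear in Corollary 2.8 admit a multiradial formulation [cf. Corollary 1.10].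
By contrast, … the cyclotomes '`μ_ℤ̂(G_v(−))`' that appear in Corollary 2.9 only admit a uniradial
formulation — i.e., unless one is willing to sacrifice the crucial cyclotomic rigidity … as in …
Corollary 1.11." Typed over abc-iut-L6-t1's radiality predicates (abstract here: `IsMultiradial`,
`IsUniradial` on a type of formulations). [claim: Mochizuki2012, status: disputed] -/
def Rmk291i_radiality {Formulation : Type u} (IsMultiradial IsUniradial : Formulation → Prop)
    (envFormulation bsFormulation : Formulation) : Prop :=
  IsMultiradial envFormulation ∧ IsUniradial bsFormulation ∧ ¬ IsMultiradial bsFormulation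

/-- **IUTchII:Rmk2.9.1(ii)** (kurims p.85 l.74) "the use of … the cyclotomes '`μ_ℤ̂(G_v(−))`' has the crucial
advantage that it allows one to apply the [not multiradially (!), but rather] uniradially defined
natural surjection `H¹(G_v(−), μ_ℤ̂(G_v(−))) ↠ ℤ̂` of Remark 1.11.5, (i), (ii)" — the field `valSurj` of
`BaseFieldThetaEvaluationData`; typed here: applying it to the orbit-set `θ^{|t|}_bs` yields a subset of
`ℤ̂` (the "values"), a singleton as soon as the surjection kills the `2l`-torsion translates.
[claim: Mochizuki2012, status: disputed] -/
theorem Rmk291ii_values (D : BaseFieldThetaEvaluationData twoL LabCusp LabAbs abs H HG Zhat)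
    (hkill : ∀ τ : HG, twoL • τ = 0 → D.valSurj τ = 0) (t : LabCusp) :
    ∃ z : Zhat, D.valSurj '' D.thetaT t = {z} := by
  obtain ⟨η, -, hη⟩ := D.thetaT_isOrbit t
  refine ⟨D.valSurj (D.res t η), ?_⟩
  rw [hη]
  apply Set.Subset.antisymm
  · rintro _ ⟨_, ⟨τ, hτ, rfl⟩, rfl⟩
    simp [map_add, hkill τ hτ]
  · rintro _ rfl
    exact ⟨D.res t η, mem_mu2lOrbit_self twoL _, rfl⟩

/-- **IUTchII:Rmk2.9.1(iii)** (kurims p.86 l.2) "the algorithms of Corollary 2.9, (ii), (iii), only give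
rise to a uniradially defined functor"; "[in [IUTchIII]] by applying the theory of log-shells …, one may
modify these algorithms in such a way as to obtain algorithms that … are manifestly multiradially
defined — albeit at the cost of allowing for certain [relatively mild!] indeterminacies". Typed: the
uniradiality clause for the Cor. 2.9 functor (abstract predicate); the forward reference is expository
(C1, noted). [claim: Mochizuki2012, status: disputed] -/
def Rmk291iii_uniradial {Fnctr : Type u} (IsUniradiallyDefined : Fnctr → Prop) (cor29Functor : Fnctr) :
    Prop :=
  IsUniradiallyDefined cor29Functor

end Cor29

end ThetaValueOrbits

end Literature.IUT.HodgeArakelov
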